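import Summits.AtomisticToContinuum.HydrodynamicLimit.Theorems.AntiMazurCoboundariesCellForecastPressureDecayEnskogObjects
import Literature.Analysis.FluidPDE.HardSphereBilliard
import HarnessLib

/-!
# S2d · kinematic assembly, piece 3: Boltzmann's collision cylinder, exactly
# (registered sub-goal `stub_kinematicAssembly_cylinder` of stub `stub_kinematicAssembly`, crux line
# `enskog-compensator-martingale`, crux `CellForecastPressureDecay`, stmt-AtomisticToContinuum-13915)

The main term of the equal-time Enskog kinematics (`KinematicRates σ`, stub S2d) is the expectation of the
two-body jump over the FRESH pairs, i.e. (piece 2, `stub_kinematicAssembly_freshPair`) over the relative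
positions `q = xᵢ − xⱼ` lying in the collision cylinder of the slab `[0, Δ]` for the relative velocity
`u = vᵢ − vⱼ`: `Cyl = {σ ω − t u : ω ∈ S², ⟪ω, u⟫ < 0, t ∈ (0, Δ]}`. This file proves the EXACT volume
element of the cylinder in the coordinates (impact direction, hitting time):

* `lintegral_collisionCylinder` — for every measurable `F ≥ 0`,
  `∫_{Cyl} F(q) dq = σ² ∫_{S²} ∫_0^Δ (⟪ω, u⟫)₋ F(σ ω − t u) dt dω`;
* `stub_kinematicAssembly_cylinder` (registered) — for a function of the impact direction
  `ω(q) = σ⁻¹ (q + τ(q) u)`, `τ = pairHitTime σ · u`: `∫_{Cyl} f(ω(q)) dq = σ² Δ ∫_{S²} (⟪ω, u⟫)₋ f(ω) dω`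
  (with the two-body jump `f` this is `σ² Δ K_w`, the `pairKernel` of the line's objects up to `ω ↦ −ω`);
* the hitting data of cylinder points (`cylMap_pairHits`, `collisionCylinder_pairHits`: `σ ω − t u` is hit
  at time exactly `t`, at direction `ω`) and the set identity `image_cylMap`.

Proof: the cylinder is the injective image of the half-ball `{p : ‖p‖ ≤ Δ, ⟪p, u⟫ < 0}` under
`Φ(p) = σ p/‖p‖ − ‖p‖ u` (`p = t ω`); `Φ'(p) = (σ/‖p‖) id + ⟪p, ·⟫ w` is a rank-one perturbation of a
homothety with `det Φ'(p) = −σ² ⟪p, u⟫/‖p‖³` (`det_smul_id_add_smulRight`, matrix determinant lemma in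
`ℝ³`); the change-of-variables formula (`lintegral_image_eq_lintegral_abs_det_fderiv_mul`) and polar
coordinates `dp = r² dr dω` (`Measure.measurePreserving_homeomorphUnitSphereProd`, `sphereMeasure =
volume.toSphere`) give `σ² |⟪ω, u⟫| dt dω`. Injectivity is read off the two-body kinematics of
`HardSphereBilliard` (`pairHitTime` is equivariant under free flight and vanishes at an incoming contact).

References: C. Cercignani, R. Illner, M. Pulvirenti, *The Mathematical Theory of Dilute Gases* (1994), §2.2
(the molecules hitting a given one within `dt` fill the cylinder of height `|V · n| dt` over the sphere of
influence); L. Boltzmann, *Vorlesungen über Gastheorie* I (1896), §3.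
-/

noncomputable section

open MeasureTheory ProbabilityTheory Set Filter Topology
open scoped ENNReal BigOperators InnerProductSpace
open Literature.Analysis.FluidPDE Literature.MathematicalPhysics.KineticTheory

namespace Summit.AtomisticToContinuum.HydrodynamicLimit.Theorems.EnskogCompensator

/-- The norm of `ℝ³` is differentiable away from the origin, with derivative `h ↦ ⟪p, h⟫/‖p‖`. [folklore] -/
theorem hasFDerivAt_norm_V3 {p : V3} (hp : p ≠ 0) :
    HasFDerivAt (fun x : V3 => ‖x‖) (‖p‖⁻¹ • innerSL ℝ p) p := by
  have h1 : HasFDerivAt (fun x : V3 => ‖x‖ ^ 2) (2 • innerSL ℝ p) p := (hasStrictFDerivAt_norm_sq p).hasFDerivAt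
  have hp2 : ‖p‖ ^ 2 ≠ 0 := pow_ne_zero 2 (norm_ne_zero_iff.2 hp)
  have h2 := h1.sqrt hp2
  have heq : (fun x : V3 => Real.sqrt (‖x‖ ^ 2)) = fun x => ‖x‖ := funext fun x => Real.sqrt_sq (norm_nonneg x)
  rw [heq] at h2
  refine h2.congr_fderiv ?_
  have hn : ‖p‖ ≠ 0 := norm_ne_zero_iff.2 hp
  ext v
  rw [Real.sqrt_sq (norm_nonneg p), two_smul]
  simp only [smul_apply, add_apply, innerSL_apply_apply, smul_eq_mul]
  field_simp
  ring

/-- `p ↦ ‖p‖⁻¹` is differentiable away from the origin, with derivative `h ↦ −⟪p, h⟫/‖p‖³`. [folklore] -/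
theorem hasFDerivAt_inv_norm_V3 {p : V3} (hp : p ≠ 0) :
    HasFDerivAt (fun x : V3 => ‖x‖⁻¹) ((-(‖p‖⁻¹ ^ 3)) • innerSL ℝ p) p := by
  have hn : ‖p‖ ≠ 0 := norm_ne_zero_iff.2 hp
  have h := (hasDerivAt_inv hn).comp_hasFDerivAt p (hasFDerivAt_norm_V3 hp)
  refine h.congr_fderiv ?_
  rw [smul_smul]
  congr 1
  field_simp

/-- The derivative of the cylinder map `Φ(p) = σ ‖p‖⁻¹ p − ‖p‖ u` at `p ≠ 0`:
`Φ'(p) h = (σ/‖p‖) h + ⟪p, h⟫ (−σ ‖p‖⁻³ p − ‖p‖⁻¹ u)`. [folklore] -/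
theorem hasFDerivAt_cylMap (σ : ℝ) (u : V3) {p : V3} (hp : p ≠ 0) :
    HasFDerivAt (fun x : V3 => σ • ‖x‖⁻¹ • x - ‖x‖ • u)
      ((σ * ‖p‖⁻¹) • ContinuousLinearMap.id ℝ V3 +
        (innerSL ℝ p).smulRight ((-(σ * ‖p‖⁻¹ ^ 3)) • p - ‖p‖⁻¹ • u)) p := by
  have h1 : HasFDerivAt (fun x : V3 => ‖x‖⁻¹ • x)
      (‖p‖⁻¹ • ContinuousLinearMap.id ℝ V3 + ((-(‖p‖⁻¹ ^ 3)) • innerSL ℝ p).smulRight p) p :=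
    (hasFDerivAt_inv_norm_V3 hp).smul (hasFDerivAt_id p)
  have h2 : HasFDerivAt (fun x : V3 => ‖x‖ • u) ((‖p‖⁻¹ • innerSL ℝ p).smulRight u) p :=
    (hasFDerivAt_norm_V3 hp).smul_const u
  have h := (h1.const_smul σ).sub h2
  refine h.congr_fderiv ?_
  ext h i
  simp only [sub_apply, smul_apply, add_apply, neg_apply, ContinuousLinearMap.id_apply,
    ContinuousLinearMap.smulRight_apply, innerSL_apply_apply, smul_add, smul_smul,
    PiLp.sub_apply, PiLp.add_apply, PiLp.smul_apply, smul_eq_mul, smul_sub, neg_smul,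
    PiLp.neg_apply]
  ring

/-- **Determinant of a rank-one perturbation of a homothety of `ℝ³`**:
`det(a·id + ⟪p, ·⟫ w) = a² (a + ⟪p, w⟫)`. [folklore] -/
theorem det_smul_id_add_smulRight (a : ℝ) (p w : V3) :
    ((a • ContinuousLinearMap.id ℝ V3 + (innerSL ℝ p).smulRight w)).det = a ^ 2 * (a + ⟪p, w⟫_ℝ) := by
  set T : V3 →L[ℝ] V3 := a • ContinuousLinearMap.id ℝ V3 + (innerSL ℝ p).smulRight w with hT
  set b := (EuclideanSpace.basisFun (Fin 3) ℝ).toBasis with hb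
  have hdet : T.det = (LinearMap.toMatrix b b (T : V3 →ₗ[ℝ] V3)).det := (LinearMap.det_toMatrix b _).symm
  have hentry : ∀ i j : Fin 3, LinearMap.toMatrix b b (T : V3 →ₗ[ℝ] V3) i j =
      a * (if i = j then 1 else 0) + p j * w i := by
    intro i j
    rw [LinearMap.toMatrix_apply]
    simp only [hb, OrthonormalBasis.coe_toBasis, EuclideanSpace.basisFun_apply,
      OrthonormalBasis.coe_toBasis_repr_apply, EuclideanSpace.basisFun_repr, ContinuousLinearMap.coe_coe,
      hT, add_apply, smul_apply, ContinuousLinearMap.id_apply,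
      ContinuousLinearMap.smulRight_apply, innerSL_apply_apply, EuclideanSpace.inner_single_right,
      PiLp.add_apply, PiLp.smul_apply, PiLp.single_apply, smul_eq_mul, RCLike.conj_to_real]
    split_ifs <;> ring
  rw [hdet, Matrix.det_fin_three]
  simp only [hentry, Fin.isValue]
  have hinner : ⟪p, w⟫_ℝ = p 0 * w 0 + p 1 * w 1 + p 2 * w 2 := by
    rw [real_inner_comm, EuclideanSpace.inner_eq_star_dotProduct]
    simp [dotProduct, Fin.sum_univ_three]
  rw [hinner]
  simp only [show (0 : Fin 3) ≠ 1 from by decide, show (0 : Fin 3) ≠ 2 from by decide,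
    show (1 : Fin 3) ≠ 0 from by decide, show (1 : Fin 3) ≠ 2 from by decide,
    show (2 : Fin 3) ≠ 0 from by decide, show (2 : Fin 3) ≠ 1 from by decide, if_true, if_false]
  ring

/-- The Jacobian determinant of the cylinder map: `det Φ'(p) = −σ² ⟪p, u⟫ / ‖p‖³`. [folklore] -/
theorem det_cylMap_deriv (σ : ℝ) (u : V3) {p : V3} (hp : p ≠ 0) :
    ((σ * ‖p‖⁻¹) • ContinuousLinearMap.id ℝ V3 +
        (innerSL ℝ p).smulRight ((-(σ * ‖p‖⁻¹ ^ 3)) • p - ‖p‖⁻¹ • u)).det =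
      -(σ ^ 2 * ‖p‖⁻¹ ^ 3 * ⟪p, u⟫_ℝ) := by
  rw [det_smul_id_add_smulRight, inner_sub_right, inner_smul_right, inner_smul_right,
    real_inner_self_eq_norm_sq]
  have hn : ‖p‖ ≠ 0 := norm_ne_zero_iff.2 hp
  field_simp
  ring


/-! ## The cylinder map: hitting data, injectivity, image -/

/-- **Hitting data of a cylinder point.** For `⟪p, u⟫ < 0` the point `q = σ ‖p‖⁻¹ p − ‖p‖ u` of the
collision cylinder is hit by the free two-body motion with relative velocity `u` exactly at time `‖p‖`:
`PairHits σ q u` and `pairHitTime σ q u = ‖p‖`. [cite: CIP1994, §2.2] -/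
theorem cylMap_pairHits {σ : ℝ} (hσ : 0 < σ) (u : V3) {p : V3} (hp : ⟪p, u⟫_ℝ < 0) :
    PairHits σ (σ • ‖p‖⁻¹ • p - ‖p‖ • u) u ∧ pairHitTime σ (σ • ‖p‖⁻¹ • p - ‖p‖ • u) u = ‖p‖ := by
  have hp0 : p ≠ 0 := fun h => by rw [h, inner_zero_left] at hp; exact lt_irrefl _ hp
  have hu0 : u ≠ 0 := fun h => by rw [h, inner_zero_right] at hp; exact lt_irrefl _ hp
  have hnp : 0 < ‖p‖ := norm_pos_iff.2 hp0
  set nv : V3 := σ • ‖p‖⁻¹ • p with hnv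
  have hn : ‖nv‖ = σ := by
    rw [hnv, norm_smul, norm_smul, norm_inv, norm_norm, inv_mul_cancel₀ hnp.ne', mul_one,
      Real.norm_of_nonneg hσ.le]
  have hnu : ⟪nv, u⟫_ℝ < 0 := by
    rw [hnv, real_inner_smul_left, real_inner_smul_left]
    exact mul_neg_of_pos_of_neg hσ (mul_neg_of_pos_of_neg (inv_pos.2 hnp) hp)
  have hhits : PairHits σ nv u := ⟨hnu, by
    simp only [pairDisc, hn, sub_self, mul_zero, sub_zero]; positivity⟩
  have h0 : pairHitTime σ nv u = 0 := (pairHitTime_eq_zero_iff hσ.le hhits).2 hn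
  have hq : σ • ‖p‖⁻¹ • p - ‖p‖ • u = nv + (-‖p‖) • u := by rw [neg_smul, sub_eq_add_neg]
  rw [hq]
  refine ⟨hhits.add_smul (by rw [h0]; exact neg_lt_zero.2 hnp), ?_⟩
  rw [pairHitTime_add_smul σ nv u hu0, h0]
  ring

/-- **Left inverse of the cylinder map**: `p` is recovered from `q = σ ‖p‖⁻¹ p − ‖p‖ u` as
`(τ/σ) (q + τ u)` with `τ = pairHitTime σ q u`. [folklore] -/
theorem cylMap_leftInv {σ : ℝ} (hσ : 0 < σ) (u : V3) {p : V3} (hp : ⟪p, u⟫_ℝ < 0) :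
    (pairHitTime σ (σ • ‖p‖⁻¹ • p - ‖p‖ • u) u / σ) •
        ((σ • ‖p‖⁻¹ • p - ‖p‖ • u) + pairHitTime σ (σ • ‖p‖⁻¹ • p - ‖p‖ • u) u • u) = p := by
  have hp0 : p ≠ 0 := fun h => by rw [h, inner_zero_left] at hp; exact lt_irrefl _ hp
  have hnp : ‖p‖ ≠ 0 := norm_ne_zero_iff.2 hp0
  rw [(cylMap_pairHits hσ u hp).2, sub_add_cancel, smul_smul, smul_smul]
  have : ‖p‖ / σ * σ * ‖p‖⁻¹ = 1 := by field_simp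
  rw [this, one_smul]

/-- The cylinder map is injective on the incoming half-space `⟪p, u⟫ < 0`. [folklore] -/
theorem injOn_cylMap {σ : ℝ} (hσ : 0 < σ) (u : V3) (Δ : ℝ) :
    InjOn (fun p : V3 => σ • ‖p‖⁻¹ • p - ‖p‖ • u) {p : V3 | ‖p‖ ≤ Δ ∧ ⟪p, u⟫_ℝ < 0} := by
  intro p hp p' hp' heq
  have h1 := cylMap_leftInv hσ u hp.2
  have h2 := cylMap_leftInv hσ u hp'.2
  simp only at heq
  rw [← h1, ← h2, heq]

/-- The parameter domain of the cylinder map is measurable. [folklore] -/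
theorem measurableSet_cylDomain (u : V3) (Δ : ℝ) :
    MeasurableSet {p : V3 | ‖p‖ ≤ Δ ∧ ⟪p, u⟫_ℝ < 0} := by
  have h1 : Measurable fun p : V3 => ⟪p, u⟫_ℝ := (continuous_id.inner continuous_const).measurable
  change MeasurableSet ({p : V3 | ‖p‖ ≤ Δ} ∩ {p : V3 | ⟪p, u⟫_ℝ < 0})
  exact (measurableSet_le continuous_norm.measurable measurable_const).inter
    (measurableSet_lt h1 measurable_const)

/-- The cylinder map is measurable. [folklore] -/
theorem measurable_cylMap (σ : ℝ) (u : V3) :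
    Measurable (fun p : V3 => σ • ‖p‖⁻¹ • p - ‖p‖ • u) :=
  ((continuous_norm.measurable.inv.smul measurable_id).const_smul σ).sub
    (continuous_norm.measurable.smul measurable_const)

/-- **The image of the cylinder map is Boltzmann's collision cylinder of the slab**: the relative
positions `q = σ ω − t u` with incoming unit impact direction `ω` (`⟪ω, u⟫ < 0`) and hitting time
`t ∈ (0, Δ]`. [cite: CIP1994, §2.2] -/
theorem image_cylMap (σ : ℝ) (u : V3) (Δ : ℝ) :
    (fun p : V3 => σ • ‖p‖⁻¹ • p - ‖p‖ • u) '' {p : V3 | ‖p‖ ≤ Δ ∧ ⟪p, u⟫_ℝ < 0} =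
      {q : V3 | ∃ (ω : Metric.sphere (0 : V3) 1) (t : ℝ), t ∈ Ioc 0 Δ ∧ ⟪(ω : V3), u⟫_ℝ < 0 ∧
        q = σ • (ω : V3) - t • u} := by
  ext q
  simp only [mem_image, mem_setOf_eq]
  constructor
  · rintro ⟨p, ⟨hpΔ, hpu⟩, rfl⟩
    have hp0 : p ≠ 0 := fun h => by rw [h, inner_zero_left] at hpu; exact lt_irrefl _ hpu
    have hnp : 0 < ‖p‖ := norm_pos_iff.2 hp0
    refine ⟨⟨‖p‖⁻¹ • p, by simp [norm_smul, inv_mul_cancel₀ hnp.ne']⟩, ‖p‖, ⟨hnp, hpΔ⟩, ?_, rfl⟩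
    change ⟪‖p‖⁻¹ • p, u⟫_ℝ < 0
    rw [real_inner_smul_left]
    exact mul_neg_of_pos_of_neg (inv_pos.2 hnp) hpu
  · rintro ⟨ω, t, ht, hωu, rfl⟩
    have hω : ‖(ω : V3)‖ = 1 := by simp
    have hnt : ‖t • (ω : V3)‖ = t := by rw [norm_smul, hω, mul_one, Real.norm_of_nonneg ht.1.le]
    refine ⟨t • (ω : V3), ⟨by rw [hnt]; exact ht.2, ?_⟩, ?_⟩
    · rw [real_inner_smul_left]; exact mul_neg_of_pos_of_neg ht.1 hωu
    · simp only [hnt, smul_smul, inv_mul_cancel₀ ht.1.ne', one_smul]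

/-! ## Polar coordinates in `ℝ³` -/

/-- **Polar coordinates in `ℝ³`** (`volume = sphereMeasure ⊗ r² dr` along `(ω, r) ↦ r ω`): for a
measurable `G : ℝ³ → [0, ∞]`, `∫ G = ∫_{S²} ∫_{r > 0} r² G(r ω) dr dω`. [folklore] -/
theorem lintegral_eq_lintegral_sphereMeasure_Ioi (G : V3 → ℝ≥0∞) (hG : Measurable G) :
    ∫⁻ p, G p = ∫⁻ ω : Metric.sphere (0 : V3) 1, ∫⁻ r in Ioi (0 : ℝ),
      ENNReal.ofReal (r ^ 2) * G (r • (ω : V3)) ∂volume ∂sphereMeasure := by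
  have hmp := (volume : Measure V3).measurePreserving_homeomorphUnitSphereProd
  have hdim : Module.finrank ℝ V3 - 1 = 2 := by simp
  rw [hdim] at hmp
  have hemb := (homeomorphUnitSphereProd V3).measurableEmbedding
  calc ∫⁻ p, G p = ∫⁻ p in ({0}ᶜ : Set V3), G p := by rw [restrict_compl_singleton]
    _ = ∫⁻ x : ({0}ᶜ : Set V3), G x ∂((volume : Measure V3).comap Subtype.val) :=
        (lintegral_subtype_comap (measurableSet_singleton (0 : V3)).compl G).symm
    _ = ∫⁻ x : ({0}ᶜ : Set V3), (G ∘ Subtype.val ∘ (homeomorphUnitSphereProd V3).symm)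
          (homeomorphUnitSphereProd V3 x) ∂((volume : Measure V3).comap Subtype.val) := by
        simp only [Function.comp_apply, Homeomorph.symm_apply_apply]
    _ = ∫⁻ y, (G ∘ Subtype.val ∘ (homeomorphUnitSphereProd V3).symm) y
          ∂((sphereMeasure : Measure (Metric.sphere (0 : V3) 1)).prod (Measure.volumeIoiPow 2)) :=
        hmp.lintegral_comp_emb hemb _
    _ = ∫⁻ ω : Metric.sphere (0 : V3) 1, ∫⁻ r, (G ∘ Subtype.val ∘ (homeomorphUnitSphereProd V3).symm) (ω, r)
          ∂(Measure.volumeIoiPow 2) ∂sphereMeasure := by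
        refine lintegral_prod _ (Measurable.aemeasurable ?_)
        exact hG.comp (measurable_subtype_coe.comp (homeomorphUnitSphereProd V3).symm.measurable)
    _ = _ := by
        refine lintegral_congr fun ω => ?_
        simp only [Function.comp_apply, homeomorphUnitSphereProd_symm_apply_coe]
        rw [Measure.volumeIoiPow, lintegral_withDensity_eq_lintegral_mul _
          (by exact (measurable_subtype_coe.pow_const 2).ennreal_ofReal)
          (by exact hG.comp ((measurable_subtype_coe).smul measurable_const)),
          ← lintegral_subtype_comap measurableSet_Ioi (fun r : ℝ => ENNReal.ofReal (r ^ 2) * G (r • (ω : V3)))]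
        rfl

/-! ## The cylinder identity -/

/-- **THE CYLINDER IDENTITY** (Boltzmann's collision cylinder, exact form). For `σ > 0`, a relative
velocity `u` and a slab length `Δ > 0`, the Lebesgue integral of any measurable `F ≥ 0` over the collision
cylinder `{σ ω − t u : ω ∈ S², ⟪ω, u⟫ < 0, t ∈ (0, Δ]}` (the relative positions whose free two-body motion
reaches contact within time `Δ`, parametrised by impact direction and hitting time) is
`σ² ∫_{S²} ∫_0^Δ (⟪ω, u⟫)₋ F(σ ω − t u) dt dω`: the volume element of the cylinder is `σ² |⟪ω, u⟫| dt dω`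
(change of variables `p = t ω ↦ σ ω − t u`, Jacobian `σ² |⟪ω, u⟫| / t²`, and polar coordinates).
In particular the cylinder has volume `π σ² ‖u‖ Δ`. [cite: CIP1994, §2.2] -/
theorem lintegral_collisionCylinder {σ Δ : ℝ} (hσ : 0 < σ) (u : V3) (F : V3 → ℝ≥0∞)
    (hF : Measurable F) :
    ∫⁻ q in (fun p : V3 => σ • ‖p‖⁻¹ • p - ‖p‖ • u) '' {p : V3 | ‖p‖ ≤ Δ ∧ ⟪p, u⟫_ℝ < 0}, F q =
      ENNReal.ofReal (σ ^ 2) * ∫⁻ ω : Metric.sphere (0 : V3) 1, ∫⁻ t in Ioc 0 Δ,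
        ENNReal.ofReal (max (-⟪(ω : V3), u⟫_ℝ) 0) * F (σ • (ω : V3) - t • u) ∂volume ∂sphereMeasure := by
  set S : Set V3 := {p : V3 | ‖p‖ ≤ Δ ∧ ⟪p, u⟫_ℝ < 0} with hS
  set Φ : V3 → V3 := fun p => σ • ‖p‖⁻¹ • p - ‖p‖ • u with hΦ
  set Φ' : V3 → V3 →L[ℝ] V3 := fun p => (σ * ‖p‖⁻¹) • ContinuousLinearMap.id ℝ V3 +
    (innerSL ℝ p).smulRight ((-(σ * ‖p‖⁻¹ ^ 3)) • p - ‖p‖⁻¹ • u) with hΦ'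
  have hSm : MeasurableSet S := measurableSet_cylDomain u Δ
  have hne : ∀ p ∈ S, p ≠ 0 := fun p hp h => by
    have := hp.2; rw [h, inner_zero_left] at this; exact lt_irrefl _ this
  have hder : ∀ p ∈ S, HasFDerivWithinAt Φ (Φ' p) S p := fun p hp =>
    (hasFDerivAt_cylMap σ u (hne p hp)).hasFDerivWithinAt
  -- the integrand after the change of variables, in closed form
  set g : V3 → ℝ≥0∞ := fun p => ENNReal.ofReal (σ ^ 2 * ‖p‖⁻¹ ^ 3 * (-⟪p, u⟫_ℝ)) * F (Φ p) with hg
  have hgm : Measurable g := by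
    refine Measurable.mul (Measurable.ennreal_ofReal ?_) (hF.comp (measurable_cylMap σ u))
    exact ((measurable_const.mul (continuous_norm.measurable.inv.pow_const 3)).mul
      ((continuous_id.inner continuous_const).measurable.neg))
  -- inner integrals in polar coordinates
  have inner_eq : ∀ ω : Metric.sphere (0 : V3) 1,
      ∫⁻ r in Ioi (0 : ℝ), ENNReal.ofReal (r ^ 2) * S.indicator g (r • (ω : V3)) =
        ENNReal.ofReal (σ ^ 2) * ∫⁻ t in Ioc 0 Δ,
          ENNReal.ofReal (max (-⟪(ω : V3), u⟫_ℝ) 0) * F (σ • (ω : V3) - t • u) := by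
    intro ω
    have hω : ‖(ω : V3)‖ = 1 := by simp
    rw [← lintegral_const_mul' _ _ ENNReal.ofReal_ne_top, ← Ioi_inter_Iic, inter_comm,
      ← Measure.restrict_restrict measurableSet_Iic, ← lintegral_indicator measurableSet_Iic]
    refine setLIntegral_congr_fun measurableSet_Ioi fun r hr => ?_
    have hr0 : (0 : ℝ) < r := hr
    have hnr : ‖r • (ω : V3)‖ = r := by rw [norm_smul, hω, mul_one, Real.norm_of_nonneg hr0.le]
    have hir : ⟪r • (ω : V3), u⟫_ℝ = r * ⟪(ω : V3), u⟫_ℝ := real_inner_smul_left _ _ _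
    have hΦr : Φ (r • (ω : V3)) = σ • (ω : V3) - r • u := by
      simp only [hΦ, hnr, smul_smul, inv_mul_cancel_right₀ hr0.ne']
    by_cases hωu : ⟪(ω : V3), u⟫_ℝ < 0
    · by_cases hrΔ : r ≤ Δ
      · have hmem : r • (ω : V3) ∈ S := ⟨by rw [hnr]; exact hrΔ, by rw [hir]; exact mul_neg_of_pos_of_neg hr0 hωu⟩
        rw [indicator_of_mem hmem, indicator_of_mem (show r ∈ Iic Δ from hrΔ), hg]
        simp only [hnr, hir, hΦr]
        rw [← mul_assoc, ← mul_assoc, ← ENNReal.ofReal_mul (sq_nonneg r), ← ENNReal.ofReal_mul (sq_nonneg σ),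
          max_eq_left (by linarith : (0 : ℝ) ≤ -⟪(ω : V3), u⟫_ℝ)]
        congr 2
        field_simp
      · have hnmem : r • (ω : V3) ∉ S := fun h => hrΔ (by rw [← hnr]; exact h.1)
        rw [indicator_of_notMem hnmem, indicator_of_notMem (show r ∉ Iic Δ from hrΔ), mul_zero]
    · have hnmem : r • (ω : V3) ∉ S := fun h =>
        hωu (lt_of_mul_lt_mul_left (by rw [mul_zero, ← hir]; exact h.2) hr0.le)
      have h0 : ENNReal.ofReal (max (-⟪(ω : V3), u⟫_ℝ) 0) = 0 := by
        rw [max_eq_right (by linarith [not_lt.1 hωu]), ENNReal.ofReal_zero]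
      rw [indicator_of_notMem hnmem, mul_zero]
      simp [Set.indicator_apply, h0]
  calc ∫⁻ q in Φ '' S, F q = ∫⁻ p in S, ENNReal.ofReal |(Φ' p).det| * F (Φ p) :=
        lintegral_image_eq_lintegral_abs_det_fderiv_mul volume hSm hder (injOn_cylMap hσ u Δ) F
    _ = ∫⁻ p in S, g p := by
        refine setLIntegral_congr_fun hSm fun p hp => ?_
        simp only [hΦ', hg]
        have hpu : ⟪p, u⟫_ℝ < 0 := hp.2
        have hnn : (0 : ℝ) ≤ σ ^ 2 * ‖p‖⁻¹ ^ 3 * -⟪p, u⟫_ℝ :=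
          mul_nonneg (by positivity) (by linarith)
        rw [det_cylMap_deriv σ u (hne p hp), neg_mul_eq_mul_neg, abs_of_nonneg hnn]
    _ = ∫⁻ p, S.indicator g p := (lintegral_indicator hSm g).symm
    _ = ∫⁻ ω : Metric.sphere (0 : V3) 1, ∫⁻ r in Ioi (0 : ℝ),
          ENNReal.ofReal (r ^ 2) * S.indicator g (r • (ω : V3)) ∂volume ∂sphereMeasure :=
        lintegral_eq_lintegral_sphereMeasure_Ioi _ (hgm.indicator hSm)
    _ = ∫⁻ ω : Metric.sphere (0 : V3) 1, ENNReal.ofReal (σ ^ 2) * ∫⁻ t in Ioc 0 Δ,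
          ENNReal.ofReal (max (-⟪(ω : V3), u⟫_ℝ) 0) * F (σ • (ω : V3) - t • u) ∂volume ∂sphereMeasure :=
        lintegral_congr inner_eq
    _ = _ := lintegral_const_mul' _ _ ENNReal.ofReal_ne_top


/-! ## Corollaries: hitting data on the cylinder and the sphere-function form -/

/-- **Hitting data on the collision cylinder**: the point `σ ω − t u` (`ω ∈ S²`, `⟪ω, u⟫ < 0`, `t > 0`)
is hit by the free two-body motion exactly at time `t`, at the impact direction `ω`. [cite: CIP1994, §2.2] -/
theorem collisionCylinder_pairHits {σ : ℝ} (hσ : 0 < σ) (u : V3) (ω : Metric.sphere (0 : V3) 1) {t : ℝ}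
    (ht : 0 < t) (hωu : ⟪(ω : V3), u⟫_ℝ < 0) :
    PairHits σ (σ • (ω : V3) - t • u) u ∧ pairHitTime σ (σ • (ω : V3) - t • u) u = t := by
  have hω : ‖(ω : V3)‖ = 1 := by simp
  have hnt : ‖t • (ω : V3)‖ = t := by rw [norm_smul, hω, mul_one, Real.norm_of_nonneg ht.le]
  have hp : ⟪t • (ω : V3), u⟫_ℝ < 0 := by rw [real_inner_smul_left]; exact mul_neg_of_pos_of_neg ht hωu
  have h := cylMap_pairHits hσ u hp
  simp only [hnt, smul_smul, inv_mul_cancel₀ ht.ne', mul_one] at h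
  exact h

/-- The first hitting time is a measurable function of the relative position. [folklore] -/
theorem measurable_pairHitTime (σ : ℝ) (u : V3) : Measurable fun q : V3 => pairHitTime σ q u := by
  unfold pairHitTime pairDisc
  refine Continuous.measurable ?_
  have h1 : Continuous fun q : V3 => ⟪q, u⟫_ℝ := continuous_id.inner continuous_const
  fun_prop

/-- **Registered sub-goal `stub_kinematicAssembly_cylinder`** (piece of stub `stub_kinematicAssembly`, S2d, of
the line `enskog-compensator-martingale`): **the exact cylinder identity for functions of the impact
direction.** For `σ > 0`, a relative velocity `u`, a slab length `Δ` and a measurable `f ≥ 0` on `ℝ³`,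
integrating `f` of the impact direction `ω(q) = σ⁻¹ (q + τ(q) u)` (`τ = pairHitTime σ · u` the first
hitting time) over Boltzmann's collision cylinder `{σ ω − t u : ω ∈ S², ⟪ω, u⟫ < 0, t ∈ (0, Δ]}` gives
`σ² Δ ∫_{S²} (⟪ω, u⟫)₋ f(ω) dω` — the kinematic factor of the hard-sphere kernel; with the two-body jump
`f(ω) = w(v') + w(u') − w(v) − w(u)` this is `σ² Δ · K_w(v, u)` (`pairKernel`, up to `ω ↦ −ω`), the exact
main term of `KinematicRates`. [cite: CIP1994, §2.2] -/
theorem stub_kinematicAssembly_cylinder : ∀ (σ Δ : ℝ) (u : V3) (f : V3 → ENNReal), 0 < σ → Measurable f →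
    ∫⁻ q in {q : V3 | ∃ (ω : Metric.sphere (0 : V3) 1) (t : ℝ), t ∈ Set.Ioc 0 Δ ∧ inner ℝ (ω : V3) u < 0 ∧
        q = σ • (ω : V3) - t • u}, f (σ⁻¹ • (q + pairHitTime σ q u • u)) =
      ENNReal.ofReal (σ ^ 2 * Δ) *
        ∫⁻ ω : Metric.sphere (0 : V3) 1, ENNReal.ofReal (max (-inner ℝ (ω : V3) u) 0) * f (ω : V3) ∂sphereMeasure := by
  intro σ Δ u f hσ hf
  have hF : Measurable fun q : V3 => f (σ⁻¹ • (q + pairHitTime σ q u • u)) :=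
    hf.comp ((measurable_id.add ((measurable_pairHitTime σ u).smul measurable_const)).const_smul σ⁻¹)
  rw [← image_cylMap σ u Δ, lintegral_collisionCylinder hσ u _ hF, ENNReal.ofReal_mul (sq_nonneg σ), mul_assoc]
  congr 1
  rw [← lintegral_const_mul' _ _ ENNReal.ofReal_ne_top]
  refine lintegral_congr fun ω => ?_
  have hinner : ∀ t ∈ Ioc 0 Δ, ENNReal.ofReal (max (-⟪(ω : V3), u⟫_ℝ) 0) *
      f (σ⁻¹ • ((σ • (ω : V3) - t • u) + pairHitTime σ (σ • (ω : V3) - t • u) u • u)) =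
        ENNReal.ofReal (max (-⟪(ω : V3), u⟫_ℝ) 0) * f (ω : V3) := by
    intro t ht
    by_cases hωu : ⟪(ω : V3), u⟫_ℝ < 0
    · rw [(collisionCylinder_pairHits hσ u ω ht.1 hωu).2, sub_add_cancel, smul_smul,
        inv_mul_cancel₀ hσ.ne', one_smul]
    · rw [max_eq_right (by linarith [not_lt.1 hωu]), ENNReal.ofReal_zero, zero_mul, zero_mul]
  rw [setLIntegral_congr_fun measurableSet_Ioc hinner, setLIntegral_const, Real.volume_Ioc, sub_zero,
    mul_comm]

end Summit.AtomisticToContinuum.HydrodynamicLimit.Theorems.EnskogCompensator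

end
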